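import Mathlib
import Summits.Schanuel.Schanuel.Theorems.RigidCoreMinimalCounterexampleInAclDefinableClassSelector
import Summits.Schanuel.Schanuel.Theorems.RigidCoreMinimalCounterexampleInAclArithmeticTransfer

/-!
# Arithmetic isolation of the LOG PART of a corank ≥ 2 first failure
# (crux stmt-Schanuel-0969 `RigidCore.MinimalCounterexampleInAcl`, line kernel-arithmetic-selection, lead c13)

`--supports stmt-Schanuel-0969`.  The corank-one sector of (S*) was closed by lead c12 with the FOURTH LEVER, arithmetic
isolation (`corankOne_holds`, Theorems/…CorankOne): the hit pattern of a first failure is arithmetical, `ℤ` lives inside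
`ℂ_exp`, and a pattern without period isolates the log coordinates.  Both halves of the lever are corank-free — the selector
`intCombos_mem_expAcl_of_definablePattern` (Theorems/…DefinableClassSelector) is stated for any number of mixed directions at every
rank.  This file packages the lever for the remaining sector of item stmt-14744, normal-form first failures of rank `n` with `r ≤ n − 2`
log directions (`e^{x_i} ∈ ℚ̄` for `i < r`), in the COORDINATE FRAME and with cast-free (`(i : ℕ) < r`-guarded) hypotheses:

* `logCoords_mem_expAcl_of_pattern_of_noFullLine` — if the copy in `ℂⁿ` of the hit pattern
  `{κ ∈ ℤⁿ : κ_i = 0 (i ≥ r), (x_i + 2πiκ_i)_{i<r} is the log part of a mate of x}` is `∅`-definable in `ℂ_exp` and no non-zero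
  integer direction supported on the log coordinates carries a full line of mates through `x`, then every LOG COORDINATE `x_i`
  (`i < r`) lies in `acl^{ℂ_exp}(∅)`;
* `logCoords_mem_expAcl_of_ringDefinable_of_noFullLine` — the same with the pattern RING-DEFINABLE over `ℤ` (transfer
  `stub_arithmeticTransfer`, Theorems/…ArithmeticTransfer); this is the form the line skeleton (gen 28) composes;
* `mem_expAcl_of_logAcl_of_fibresFinite` — the relative pure residue is a FIBRE-FINITENESS statement: if the log coordinates are
  in `acl(∅)` and every relative pure fibre `{x' mate : x'_i = y_i (i < r)}` (`y` a mate) is finite, then all coordinates of `x`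
  are in `acl(∅)` (the slice of the mate class over finite `∅`-definable sets containing the log coordinates is a finite union of
  fibres, hence a finite `∅`-definable set of tuples containing `x`; project).

So on the corank ≥ 2 sector: (S*) ⟸ [hit pattern ring-definable — TRUE for every first failure (mates are isolated points of
`V_x ∩ Γ_exp`), stub `stub_corankGeTwo_hitSetRingDefinable`] ∧ [no full line, stub `stub_corankGeTwo_noFullLine`] ∧ [relative pure
isolation given the log coordinates, stub `stub_corankGeTwo_relResidue` ⟸ uniform finiteness of the relative pure fibres].

References: status note `Cruxes/MinimalCounterexampleInAcl/Lines/kernel_arithmetic_selection.md` §Addendum c12/c13;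
[KirbyMacintyreOnshuus2012] J. Kirby, A. Macintyre, A. Onshuus, *The algebraic numbers definable in various exponential fields*,
J. Inst. Math. Jussieu 11 (2012) §2; [Kirby2010] J. Kirby, *Exponential algebraicity in exponential fields*, Bull. LMS 42 (2010),
Prop. 7.2.
-/

noncomputable section

set_option linter.dupNamespace false

open Complex Set FirstOrder

namespace Summit.Schanuel.Schanuel.Cruxes.MinimalCounterexampleInAcl.KernelArithmeticSelection

open Literature.ModelTheory.ExponentialFields
open Summit.Schanuel.Schanuel.Theorems.AclSubsetLogFreeCore.Negative

variable {n r : ℕ}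

/-! ## The coordinate frame of the first `r` coordinates -/

/-- In the coordinate frame `M_k = e_k` (`k < r ≤ n`, written cast-free as the indicator of `(i : ℕ) = k`), the `k`-th integer
combination of `y` is the coordinate `y_k`. [folklore] -/
theorem coordFrameLT_sum (hr : r ≤ n) (y : Fin n → ℂ) (k : Fin r) :
    (∑ i : Fin n, (((fun (k : Fin r) (i : Fin n) => if (i : ℕ) = (k : ℕ) then (1 : ℤ) else 0) k i : ℤ) : ℂ) * y i) =
      y (Fin.castLE hr k) := by
  rw [Finset.sum_eq_single (Fin.castLE hr k)]
  · simp
  · intro i _ hi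
    have : (i : ℕ) ≠ (k : ℕ) := fun h => hi (Fin.ext (by simpa using h))
    simp [this]
  · intro h; exact absurd (Finset.mem_univ _) h

/-- The value set of the coordinate frame: log parts of mates. [folklore] -/
theorem valueTuples_coordFrameLT (hr : r ≤ n) (x : Fin n → ℂ) :
    {v : Fin r → ℂ | ∃ x' ∈ locusMates x, ∀ k,
        v k = ∑ i : Fin n, (((fun (k : Fin r) (i : Fin n) => if (i : ℕ) = (k : ℕ) then (1 : ℤ) else 0) k i : ℤ) : ℂ) * x' i} =
      {v : Fin r → ℂ | ∃ x' ∈ locusMates x, ∀ k, v k = x' (Fin.castLE hr k)} := by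
  ext v
  simp only [mem_setOf_eq, coordFrameLT_sum hr]

/-! ## From the cast-free `ℂⁿ`-form of the pattern to the frame form -/

/-- Extension by zero of an integer vector on the first `r` coordinates. [folklore] -/
theorem extendByZero_apply_castLE (hr : r ≤ n) (κ : Fin r → ℤ) (k : Fin r) :
    (fun i : Fin n => if h : (i : ℕ) < r then κ ⟨i, h⟩ else 0) (Fin.castLE hr k) = κ k := by
  have hk : ((Fin.castLE hr k : Fin n) : ℕ) < r := by simp
  simp only [hk, dif_pos]
  congr 1

/-- **Frame form of a definable `ℂⁿ`-pattern.**  If the cast-free copy in `ℂⁿ` of the hit pattern of the log part is `∅`-definable,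
so is its copy in `ℂ^r` in the coordinate frame (projection `Set.Definable.image_comp` along `Fin.castLE`). [folklore] -/
theorem framePattern_definable_of_pattern (hr : r ≤ n) {x : Fin n → ℂ}
    (hP : (∅ : Set ℂ).Definable Language.expRing
      {w : Fin n → ℂ | ∃ κ : Fin n → ℤ, (∀ i, w i = (κ i : ℂ)) ∧ (∀ i : Fin n, r ≤ (i : ℕ) → κ i = 0) ∧
        ∃ x' ∈ locusMates x, ∀ i : Fin n, (i : ℕ) < r → x' i = x i + 2 * ↑Real.pi * I * (κ i : ℂ)}) :
    (∅ : Set ℂ).Definable Language.expRing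
      {w : Fin r → ℂ | ∃ κ : Fin r → ℤ, (∀ k, w k = (κ k : ℂ)) ∧
        (fun k => x (Fin.castLE hr k) + 2 * ↑Real.pi * I * (κ k : ℂ)) ∈
          {v : Fin r → ℂ | ∃ x' ∈ locusMates x, ∀ k, v k = x' (Fin.castLE hr k)}} := by
  have himg := hP.image_comp (Fin.castLE hr)
  convert himg using 1
  ext w
  simp only [mem_setOf_eq, mem_image]
  constructor
  · rintro ⟨κ, hw, x', hx', hv⟩
    refine ⟨fun i => if h : (i : ℕ) < r then (κ ⟨i, h⟩ : ℂ) else 0, ⟨fun i => if h : (i : ℕ) < r then κ ⟨i, h⟩ else 0,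
      fun i => ?_, fun i hi => ?_, x', hx', fun i hi => ?_⟩, ?_⟩
    · by_cases h : (i : ℕ) < r <;> simp [h]
    · have : ¬ (i : ℕ) < r := not_lt.2 hi
      simp [this]
    · have := hv ⟨i, hi⟩
      simp only [hi, dif_pos]
      simpa using this.symm
    · funext k
      have hk : ((Fin.castLE hr k : Fin n) : ℕ) < r := by simp
      simp only [Function.comp_apply, hk, dif_pos, hw k]
      congr 1
  · rintro ⟨v, ⟨κ, hv, hκ0, x', hx', hx'v⟩, rfl⟩
    refine ⟨fun k => κ (Fin.castLE hr k), fun k => by simp [hv], x', hx', fun k => ?_⟩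
    have := hx'v (Fin.castLE hr k) (by simp)
    simpa using this.symm

/-- **Frame form of "no full line".**  If no non-zero integer direction supported on the log coordinates carries a full line of
mates through `x` (cast-free form), then the same holds in the coordinate frame over `Fin r`. [folklore] -/
theorem frameNoFullLine_of_noFullLine (hr : r ≤ n) {x : Fin n → ℂ}
    (hno : ∀ μ : Fin n → ℤ, (∀ i : Fin n, r ≤ (i : ℕ) → μ i = 0) → μ ≠ 0 → ∃ j : ℤ,
      ¬ ∃ x' ∈ locusMates x, ∀ i : Fin n, (i : ℕ) < r → x' i = x i + 2 * ↑Real.pi * I * ((j • μ) i : ℂ)) :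
    ∀ μ : Fin r → ℤ, μ ≠ 0 → ∃ j : ℤ,
      (fun k => x (Fin.castLE hr k) + 2 * ↑Real.pi * I * ((j • μ : Fin r → ℤ) k : ℂ)) ∉
        {v : Fin r → ℂ | ∃ x' ∈ locusMates x, ∀ k, v k = x' (Fin.castLE hr k)} := by
  intro μ hμ
  set μ' : Fin n → ℤ := fun i => if h : (i : ℕ) < r then μ ⟨i, h⟩ else 0 with hμ'
  have hsupp : ∀ i : Fin n, r ≤ (i : ℕ) → μ' i = 0 := fun i hi => by
    have : ¬ (i : ℕ) < r := not_lt.2 hi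
    simp [hμ', this]
  have hne : μ' ≠ 0 := by
    intro h
    apply hμ
    funext k
    have := congr_fun h (Fin.castLE hr k)
    rw [hμ', extendByZero_apply_castLE hr μ k] at this
    simpa using this
  obtain ⟨j, hj⟩ := hno μ' hsupp hne
  refine ⟨j, ?_⟩
  rintro ⟨x', hx', hv⟩
  apply hj
  refine ⟨x', hx', fun i hi => ?_⟩
  have := hv ⟨i, hi⟩
  simp only [Pi.smul_apply, smul_eq_mul, Int.cast_mul] at this ⊢
  have e : μ' i = μ ⟨i, hi⟩ := by simp [hμ', hi]
  rw [e]
  simpa using this.symm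

/-! ## The log part of a corank ≥ 2 first failure is in `acl(∅)`, modulo [definable pattern] ∧ [no full line] -/

/-- **LOG COORDINATES IN `acl(∅)` FROM A DEFINABLE HIT PATTERN WITHOUT FULL LINES (every rank, any number `r ≤ n` of log
directions).**  Let `x` be ℚ-linearly independent with `e^{x_i}` algebraic for `i < r`.  If the copy in `ℂⁿ` of the hit pattern of the
log part is `∅`-definable in `ℂ_exp` and no non-zero integer direction supported on the log coordinates carries a full line of mates
through `x`, then `x_i ∈ acl^{ℂ_exp}(∅)` for every `i < r` (the definable-class selector `intCombos_mem_expAcl_of_definablePattern` in the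
coordinate frame). [cite: KirbyMacintyreOnshuus2012, §2] -/
theorem logCoords_mem_expAcl_of_pattern_of_noFullLine (hr : r ≤ n) {x : Fin n → ℂ} (hx : LinearIndependent ℚ x)
    (halg : ∀ i : Fin n, (i : ℕ) < r → IsAlgebraic ℚ (cexp (x i)))
    (hP : (∅ : Set ℂ).Definable Language.expRing
      {w : Fin n → ℂ | ∃ κ : Fin n → ℤ, (∀ i, w i = (κ i : ℂ)) ∧ (∀ i : Fin n, r ≤ (i : ℕ) → κ i = 0) ∧
        ∃ x' ∈ locusMates x, ∀ i : Fin n, (i : ℕ) < r → x' i = x i + 2 * ↑Real.pi * I * (κ i : ℂ)})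
    (hno : ∀ μ : Fin n → ℤ, (∀ i : Fin n, r ≤ (i : ℕ) → μ i = 0) → μ ≠ 0 → ∃ j : ℤ,
      ¬ ∃ x' ∈ locusMates x, ∀ i : Fin n, (i : ℕ) < r → x' i = x i + 2 * ↑Real.pi * I * ((j • μ) i : ℂ)) :
    ∀ i : Fin n, (i : ℕ) < r → x i ∈ expAcl := by
  set M : Fin r → Fin n → ℤ := fun k i => if (i : ℕ) = (k : ℕ) then 1 else 0 with hM
  have hsum : ∀ (y : Fin n → ℂ) (k : Fin r), (∑ i, (M k i : ℂ) * y i) = y (Fin.castLE hr k) :=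
    fun y k => coordFrameLT_sum hr y k
  have hV : {v : Fin r → ℂ | ∃ x' ∈ locusMates x, ∀ k, v k = ∑ i, (M k i : ℂ) * x' i} =
      {v : Fin r → ℂ | ∃ x' ∈ locusMates x, ∀ k, v k = x' (Fin.castLE hr k)} := valueTuples_coordFrameLT hr x
  have hu : (fun k => ∑ i, (M k i : ℂ) * x i) = fun k => x (Fin.castLE hr k) := funext fun k => hsum x k
  have halg' : ∀ k, IsAlgebraic ℚ (cexp (∑ i, (M k i : ℂ) * x i)) := fun k => by
    rw [hsum]; exact halg _ (by simp)
  have hHdef : (∅ : Set ℂ).Definable Language.expRing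
      {w : Fin r → ℂ | ∃ κ : Fin r → ℤ, (∀ k, w k = (κ k : ℂ)) ∧
        (fun k => (∑ i, (M k i : ℂ) * x i) + 2 * ↑Real.pi * I * (κ k : ℂ)) ∈
          {v : Fin r → ℂ | ∃ x' ∈ locusMates x, ∀ k, v k = ∑ i, (M k i : ℂ) * x' i}} := by
    rw [hV]
    simp only [hsum]
    exact framePattern_definable_of_pattern hr hP
  have hno' : ∀ μ : Fin r → ℤ, μ ≠ 0 → ∃ j : ℤ,
      (fun k => (∑ i, (M k i : ℂ) * x i) + 2 * ↑Real.pi * I * ((j • μ : Fin r → ℤ) k : ℂ)) ∉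
        {v : Fin r → ℂ | ∃ x' ∈ locusMates x, ∀ k, v k = ∑ i, (M k i : ℂ) * x' i} := by
    rw [hV]
    simp only [hsum]
    exact frameNoFullLine_of_noFullLine hr hno
  have key := intCombos_mem_expAcl_of_definablePattern hx M halg' hHdef hno'
  intro i hi
  have h := key ⟨i, hi⟩
  rw [hsum] at h
  simpa using h

/-- **The same from a RING-DEFINABLE pattern** (the form composed by the line skeleton): if the hit pattern of the log part, as a subset
of `ℤⁿ`, is `∅`-definable in the ring `ℤ` (Mathlib's ring structure), then its copy in `ℂⁿ` is `∅`-definable in `ℂ_exp`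
(`stub_arithmeticTransfer`: `ℤ` with its ring operations is `∅`-definable in `ℂ_exp`), and the previous theorem applies.
[cite: KirbyMacintyreOnshuus2012, §2] -/
theorem logCoords_mem_expAcl_of_ringDefinable_of_noFullLine (hr : r ≤ n) {x : Fin n → ℂ} (hx : LinearIndependent ℚ x)
    (halg : ∀ i : Fin n, (i : ℕ) < r → IsAlgebraic ℚ (cexp (x i)))
    (hA : letI := FirstOrder.Ring.compatibleRingOfRing ℤ
      (∅ : Set ℤ).Definable FirstOrder.Language.ring
        {κ : Fin n → ℤ | (∀ i : Fin n, r ≤ (i : ℕ) → κ i = 0) ∧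
          ∃ x' ∈ locusMates x, ∀ i : Fin n, (i : ℕ) < r → x' i = x i + 2 * ↑Real.pi * I * (κ i : ℂ)})
    (hno : ∀ μ : Fin n → ℤ, (∀ i : Fin n, r ≤ (i : ℕ) → μ i = 0) → μ ≠ 0 → ∃ j : ℤ,
      ¬ ∃ x' ∈ locusMates x, ∀ i : Fin n, (i : ℕ) < r → x' i = x i + 2 * ↑Real.pi * I * ((j • μ) i : ℂ)) :
    ∀ i : Fin n, (i : ℕ) < r → x i ∈ expAcl := by
  refine logCoords_mem_expAcl_of_pattern_of_noFullLine hr hx halg ?_ hno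
  have hT := stub_arithmeticTransfer n _ hA
  convert hT using 1
  ext w
  simp only [mem_setOf_eq]
  constructor
  · rintro ⟨κ, hw, hκ0, hx'⟩
    exact ⟨κ, ⟨hκ0, hx'⟩, hw⟩
  · rintro ⟨κ, ⟨hκ0, hx'⟩, hw⟩
    exact ⟨κ, hw, hκ0, hx'⟩

/-! ## The relative pure residue is fibre finiteness -/

/-- **ALL COORDINATES IN `acl(∅)` FROM [LOG COORDINATES IN `acl(∅)`] ∧ [UNIFORM FINITENESS OF THE RELATIVE PURE FIBRES]** (every rank,
any `r`).  If `x` is ℚ-linearly independent, `x_i ∈ acl(∅)` for `i < r`, and for every mate `y` of `x` the relative pure fibre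
`{x' mate : x'_i = y_i for i < r}` is finite, then every coordinate of `x` is in `acl^{ℂ_exp}(∅)`: the slice of the (`∅`-definable)
mate class cut out by finite `∅`-definable sets `s_i ∋ x_i` (`i < r`) is a finite union of fibres, so it is a finite `∅`-definable
set of tuples containing `x`; project (`coord_mem_expAcl`). [cite: Kirby2010, Prop. 7.2] -/
theorem mem_expAcl_of_logAcl_of_fibresFinite {x : Fin n → ℂ} (hx : LinearIndependent ℚ x)
    (hlog : ∀ i : Fin n, (i : ℕ) < r → x i ∈ expAcl)
    (hfib : ∀ y ∈ locusMates x, {x' ∈ locusMates x | ∀ i : Fin n, (i : ℕ) < r → x' i = y i}.Finite) :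
    ∀ i, x i ∈ expAcl := by
  classical
  -- finite `∅`-definable sets around the log coordinates (and `{x i}` as a placeholder elsewhere — only used for `i < r`)
  have hch : ∀ i : Fin n, ∃ s : Set ℂ, ((i : ℕ) < r → s.Finite ∧ Set.Definable₁ (∅ : Set ℂ) Language.expRing s) ∧ x i ∈ s := by
    intro i
    by_cases hi : (i : ℕ) < r
    · obtain ⟨s, hsfin, hsdef, hxs⟩ := hlog i hi
      exact ⟨s, fun _ => ⟨hsfin, hsdef⟩, hxs⟩
    · exact ⟨{x i}, fun h => absurd h hi, rfl⟩
  choose s hs hxs using hch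
  -- the slice
  set S : Set (Fin n → ℂ) := locusMates x ∩ ⋂ i : {i : Fin n // (i : ℕ) < r}, {y : Fin n → ℂ | y i.1 ∈ s i.1} with hS
  have hxS : x ∈ S := ⟨self_mem_locusMates x hx, Set.mem_iInter.2 fun i => hxs i.1⟩
  have hSdef : (∅ : Set ℂ).Definable Language.expRing S := by
    refine (locusMates_definable x).inter (Set.definable_iInter_of_finite fun i => ?_)
    have e : {y : Fin n → ℂ | y i.1 ∈ s i.1} = (fun g : Fin n → ℂ => g ∘ fun _ : Fin 1 => i.1) ⁻¹' {v : Fin 1 → ℂ | v 0 ∈ s i.1} := by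
      ext y; simp
    rw [e]
    exact ((hs i.1 i.2).2).preimage_comp _
  have hSfin : S.Finite := by
    -- the finitely many possible log parts
    set T : Set (Fin n → ℂ) := Set.pi Set.univ fun i => if (i : ℕ) < r then s i else {0} with hT
    have hTfin : T.Finite := Set.Finite.pi fun i => by
      by_cases hi : (i : ℕ) < r
      · simp only [hi, if_true]; exact (hs i hi).1
      · simp only [hi, if_false]; exact Set.finite_singleton 0
    -- each fibre over a log part is finite
    have hFfin : ∀ c ∈ T, ({x' ∈ locusMates x | ∀ i : Fin n, (i : ℕ) < r → x' i = c i}).Finite := by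
      intro c _
      by_cases hne : ({x' ∈ locusMates x | ∀ i : Fin n, (i : ℕ) < r → x' i = c i}).Nonempty
      · obtain ⟨y, hyM, hyc⟩ := hne
        refine (hfib y hyM).subset ?_
        rintro x' ⟨hx'M, hx'c⟩
        exact ⟨hx'M, fun i hi => by rw [hx'c i hi, hyc i hi]⟩
      · rw [Set.not_nonempty_iff_eq_empty.1 hne]; exact Set.finite_empty
    refine (hTfin.biUnion hFfin).subset ?_
    rintro y ⟨hyM, hys⟩
    have hys' := Set.mem_iInter.1 hys
    refine Set.mem_iUnion₂.2 ⟨fun i => if (i : ℕ) < r then y i else 0, ?_, hyM, fun i hi => by simp [hi]⟩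
    refine Set.mem_univ_pi.2 fun i => ?_
    by_cases hi : (i : ℕ) < r
    · simp only [hi, if_true]; exact hys' ⟨i, hi⟩
    · simp [hi]
  intro i
  exact coord_mem_expAcl hSfin hSdef hxS i

/-! ## Normal-form corollary for the corank ≥ 2 sector (the composition used by the line skeleton, gen 28) -/

/-- **(S*) ON THE CORANK ≥ 2 SECTOR FROM THREE PIECES.**  For normal-form first failures of rank `n ≥ 3` with `r ≤ n − 2` log directions:
[the hit pattern of the log part is ring-definable over `ℤ`] ∧ [no full line in a log direction] ∧ [relative pure isolation: log
coordinates in `acl(∅)` ⇒ all coordinates in `acl(∅)`] imply that every coordinate is in `acl^{ℂ_exp}(∅)`. [cite: Kirby2010, Prop. 7.2] -/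
theorem corankGeTwo_of_pieces
    (hA : ∀ (n r : ℕ), 3 ≤ n → r + 2 ≤ n → ∀ x : Fin n → ℂ, x ∈ firstFailures n →
      (∀ i : Fin n, (i : ℕ) < r → IsAlgebraic ℚ (cexp (x i))) →
      (∀ M : Fin n → ℤ, (∃ i : Fin n, r ≤ (i : ℕ) ∧ M i ≠ 0) → Transcendental ℚ (cexp (∑ i, (M i : ℂ) * x i))) →
      letI := FirstOrder.Ring.compatibleRingOfRing ℤ
      (∅ : Set ℤ).Definable FirstOrder.Language.ring
        {κ : Fin n → ℤ | (∀ i : Fin n, r ≤ (i : ℕ) → κ i = 0) ∧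
          ∃ x' ∈ locusMates x, ∀ i : Fin n, (i : ℕ) < r → x' i = x i + 2 * ↑Real.pi * I * (κ i : ℂ)})
    (hB : ∀ (n r : ℕ), 3 ≤ n → r + 2 ≤ n → ∀ x : Fin n → ℂ, x ∈ firstFailures n →
      (∀ i : Fin n, (i : ℕ) < r → IsAlgebraic ℚ (cexp (x i))) →
      (∀ M : Fin n → ℤ, (∃ i : Fin n, r ≤ (i : ℕ) ∧ M i ≠ 0) → Transcendental ℚ (cexp (∑ i, (M i : ℂ) * x i))) →
      ∀ μ : Fin n → ℤ, (∀ i : Fin n, r ≤ (i : ℕ) → μ i = 0) → μ ≠ 0 → ∃ j : ℤ,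
        ¬ ∃ x' ∈ locusMates x, ∀ i : Fin n, (i : ℕ) < r → x' i = x i + 2 * ↑Real.pi * I * ((j • μ) i : ℂ))
    (hC : ∀ (n r : ℕ), 3 ≤ n → r + 2 ≤ n → ∀ x : Fin n → ℂ, x ∈ firstFailures n →
      (∀ i : Fin n, (i : ℕ) < r → IsAlgebraic ℚ (cexp (x i))) →
      (∀ M : Fin n → ℤ, (∃ i : Fin n, r ≤ (i : ℕ) ∧ M i ≠ 0) → Transcendental ℚ (cexp (∑ i, (M i : ℂ) * x i))) →
      (∀ i : Fin n, (i : ℕ) < r → x i ∈ expAcl) → ∀ i, x i ∈ expAcl) :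
    ∀ (n r : ℕ), 3 ≤ n → r + 2 ≤ n → ∀ x : Fin n → ℂ, x ∈ firstFailures n →
      (∀ i : Fin n, (i : ℕ) < r → IsAlgebraic ℚ (cexp (x i))) →
      (∀ M : Fin n → ℤ, (∃ i : Fin n, r ≤ (i : ℕ) ∧ M i ≠ 0) → Transcendental ℚ (cexp (∑ i, (M i : ℂ) * x i))) →
      ∀ i, x i ∈ expAcl := by
  intro n r hn hr x hx halg hpure
  refine hC n r hn hr x hx halg hpure ?_
  exact logCoords_mem_expAcl_of_ringDefinable_of_noFullLine (by omega) hx.1 halg (hA n r hn hr x hx halg hpure)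
    (hB n r hn hr x hx halg hpure)


/-! ## Registered form (`ledger workitem stub-add stmt-Schanuel-0969 --name stub_corankGeTwo_logPart …`) -/

set_option linter.unusedVariables false in -- the registered signature names the instance binder `inst`
/-- Registered form of `logCoords_mem_expAcl_of_ringDefinable_of_noFullLine` (stub `stub_corankGeTwo_logPart` of crux stmt-Schanuel-0969,
line kernel-arithmetic-selection, lead c13): **the log coordinates of a ℚ-linearly independent tuple with algebraic exponentials in its
first `r` directions are in `acl^{ℂ_exp}(∅)` as soon as the hit pattern of the log part is ring-definable over `ℤ` and no log direction
carries a full line of mates** (every rank, any `r ≤ n`). -/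
theorem stub_corankGeTwo_logPart : ∀ (n r : ℕ), r ≤ n → ∀ (x : Fin n → ℂ), LinearIndependent ℚ x → (∀ i : Fin n, (i : ℕ) < r → IsAlgebraic ℚ (Complex.exp (x i))) → (∀ [inst : FirstOrder.Ring.CompatibleRing ℤ], (∅ : Set ℤ).Definable FirstOrder.Language.ring {κ : Fin n → ℤ | (∀ i : Fin n, r ≤ (i : ℕ) → κ i = 0) ∧ ∃ x' ∈ Summit.Schanuel.Schanuel.Cruxes.MinimalCounterexampleInAcl.KernelArithmeticSelection.locusMates x, ∀ i : Fin n, (i : ℕ) < r → x' i = x i + 2 * ↑Real.pi * Complex.I * (κ i : ℂ)}) → (∀ μ : Fin n → ℤ, (∀ i : Fin n, r ≤ (i : ℕ) → μ i = 0) → μ ≠ 0 → ∃ j : ℤ, ¬ ∃ x' ∈ Summit.Schanuel.Schanuel.Cruxes.MinimalCounterexampleInAcl.KernelArithmeticSelection.locusMates x, ∀ i : Fin n, (i : ℕ) < r → x' i = x i + 2 * ↑Real.pi * Complex.I * ((j • μ) i : ℂ)) → ∀ i : Fin n, (i : ℕ) < r → x i ∈ Summit.Schanuel.Schanuel.Theorems.AclSubsetLogFreeCore.Negative.expAcl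 :=
  fun n r hr x hx halg hA hno =>
    logCoords_mem_expAcl_of_ringDefinable_of_noFullLine hr hx halg (@hA (FirstOrder.Ring.compatibleRingOfRing ℤ)) hno

end Summit.Schanuel.Schanuel.Cruxes.MinimalCounterexampleInAcl.KernelArithmeticSelection

end
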